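import Literature.MathematicalPhysics.QuantumLattice.EmeryThreeBandStatesNonempty
import Literature.MathematicalPhysics.QuantumLattice.SuperlatticeCellFillingConvexity
import HarnessLib

/-!
# The three-band (Emery) ground-state energy density is CONVEX in the cell filling; chords of caps are caps

Topic `MathematicalPhysics/QuantumLattice`, family `hubbard`. `SuperlatticeCellFillingConvexity` proves that the variational
cell energy over `q`-periodic states is convex in the cell filling (mixtures of periodic states are periodic; cell energy
and cell filling are affine — Ruelle 1969 §3.4). The variational class of the decorated three-band model,
`emeryStates ρ` (`EmeryThreeBandByDecoration`: `2×2`-periodic, EMPTY on the dummy sublattice, cell filling `ρ`), is closed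
under mixtures as well (the dummy-site density is affine), so the same argument gives:

* `mix_mem_emeryStates`; **`emeryEnergyDensity_convex_comb_le`** (three-point form on realised fillings) and
  **`convexOn_emeryEnergyDensity_filling`**: `ρ ↦ e_Emery(θ, ρ)` is convex on `[0, 3/2]` for every coupling vector `θ`;
* **`emeryEnergyDensity_le_chord_of_caps`**: caps at two fillings `ρ₁ < ρ₂` in `[0, 3/2]` give the CHORD cap at every
  filling between them — the door through which cluster-vector caps at the commensurate fillings `N/16`
  (`emeryEnergyDensity_le_block2x2_rayleigh`, `N = 19, 20, 21, …`) cap the DOPED boxes (`ρ ∉ ℕ/16`).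

(Concavity in the couplings is `concaveOn_emeryEnergyDensity`; this file is the filling direction.)
Everything is proved; no named fact; nothing numerical is asserted here.

## References

* D. Ruelle, *Statistical Mechanics: Rigorous Results* (1969), §3.4 (convexity of the energy in the density by mixing).
  [cite: Ruelle1969, §3.4]
* O. Bratteli, D. W. Robinson, *Operator Algebras and Quantum Statistical Mechanics I* (1987), §4.3.1 (mixtures of states).
  [cite: BratteliRobinsonI1987, §4.3.1]
-/

noncomputable section

namespace Literature.MathematicalPhysics.QuantumLattice

open InfVolFermionState

/-- **Mixtures stay in the three-band variational class**: the mixture of states of `emeryStates ρ₁`, `emeryStates ρ₂` with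
weight `t` lies in `emeryStates (tρ₁ + (1−t)ρ₂)`. [cite: BratteliRobinsonI1987, §4.3.1] -/
theorem mix_mem_emeryStates {ρ₁ ρ₂ : ℝ} {ω₁ ω₂ : InfVolFermionState 2} (h₁ : ω₁ ∈ emeryStates ρ₁) (h₂ : ω₂ ∈ emeryStates ρ₂)
    (t : ℝ) (ht₀ : 0 ≤ t) (ht₁ : t ≤ 1) :
    InfVolFermionState.mix t ht₀ ht₁ ω₁ ω₂ ∈ emeryStates (t * ρ₁ + (1 - t) * ρ₂) := by
  obtain ⟨hp₁, hd₁, hf₁⟩ := h₁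
  obtain ⟨hp₂, hd₂, hf₂⟩ := h₂
  refine ⟨hp₁.mix hp₂ t ht₀ ht₁, ?_, ?_⟩
  · rw [shift_mix, density_mix, hd₁, hd₂]; ring
  · rw [cellFilling_mix, hf₁, hf₂]

/-- **CONVEXITY IN THE CELL FILLING, three-point form**: for realised fillings `ρ₁, ρ₂` and `a, b ≥ 0`, `a + b = 1`,
`e(θ, aρ₁ + bρ₂) ≤ a·e(θ, ρ₁) + b·e(θ, ρ₂)` (mix near-minimisers). [cite: Ruelle1969, §3.4] -/
theorem emeryEnergyDensity_convex_comb_le (θ : Fin 14 → ℝ) {ρ₁ ρ₂ : ℝ} (h₁ : (emeryStates ρ₁).Nonempty)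
    (h₂ : (emeryStates ρ₂).Nonempty) {a b : ℝ} (ha : 0 ≤ a) (hb : 0 ≤ b) (hab : a + b = 1) :
    emeryEnergyDensity θ (a * ρ₁ + b * ρ₂) ≤ a * emeryEnergyDensity θ ρ₁ + b * emeryEnergyDensity θ ρ₂ := by
  unfold emeryEnergyDensity
  refine le_of_forall_pos_le_add fun ε hε => ?_
  obtain ⟨ω₁, hω₁, he₁⟩ := exists_cellEnergy_lt_of_infCellEnergyOn_lt 1 (emeryViews θ) h₁
    (lt_add_of_pos_right (infCellEnergyOn (emeryStates ρ₁) (emeryViews θ) 1) hε)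
  obtain ⟨ω₂, hω₂, he₂⟩ := exists_cellEnergy_lt_of_infCellEnergyOn_lt 1 (emeryViews θ) h₂
    (lt_add_of_pos_right (infCellEnergyOn (emeryStates ρ₂) (emeryViews θ) 1) hε)
  have ha1 : a ≤ 1 := by linarith
  have hmix : InfVolFermionState.mix a ha ha1 ω₁ ω₂ ∈ emeryStates (a * ρ₁ + b * ρ₂) := by
    have h := mix_mem_emeryStates hω₁ hω₂ a ha ha1
    rwa [show 1 - a = b by linarith] at h
  have hle := infCellEnergyOn_le_cellEnergy (emeryViews θ) 1 hmix
  rw [cellEnergy_mix, show 1 - a = b by linarith] at hle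
  nlinarith [mul_le_mul_of_nonneg_left he₁.le ha, mul_le_mul_of_nonneg_left he₂.le hb]

/-- **THE THREE-BAND ENERGY DENSITY IS CONVEX IN THE CELL FILLING on `[0, 3/2]`** (the realised fillings,
`emeryStates_nonempty`), for every coupling vector. [cite: Ruelle1969, §3.4] -/
theorem convexOn_emeryEnergyDensity_filling (θ : Fin 14 → ℝ) :
    ConvexOn ℝ (Set.Icc (0 : ℝ) (3 / 2)) (fun ρ => emeryEnergyDensity θ ρ) := by
  refine ⟨convex_Icc _ _, fun x hx y hy a b ha hb hab => ?_⟩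
  simp only [smul_eq_mul]
  exact emeryEnergyDensity_convex_comb_le θ (emeryStates_nonempty hx.1 hx.2) (emeryStates_nonempty hy.1 hy.2) ha hb hab

/-- **CHORDS OF CAPS ARE CAPS**: if `e(θ, ρ₁) ≤ c₁` and `e(θ, ρ₂) ≤ c₂` at fillings `0 ≤ ρ₁ < ρ₂ ≤ 3/2`, then at every filling
`ρ ∈ [ρ₁, ρ₂]`, `e(θ, ρ) ≤ c₁ + (c₂ − c₁)·(ρ − ρ₁)/(ρ₂ − ρ₁)` — cluster-vector caps at commensurate fillings cap the doped boxes.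
[cite: Ruelle1969, §3.4] -/
theorem emeryEnergyDensity_le_chord_of_caps (θ : Fin 14 → ℝ) {ρ₁ ρ₂ c₁ c₂ : ℝ} (hρ₁ : 0 ≤ ρ₁) (h12 : ρ₁ < ρ₂)
    (hρ₂ : ρ₂ ≤ 3 / 2) (hc₁ : emeryEnergyDensity θ ρ₁ ≤ c₁) (hc₂ : emeryEnergyDensity θ ρ₂ ≤ c₂) {ρ : ℝ}
    (hlo : ρ₁ ≤ ρ) (hhi : ρ ≤ ρ₂) :
    emeryEnergyDensity θ ρ ≤ c₁ + (c₂ - c₁) * (ρ - ρ₁) / (ρ₂ - ρ₁) := by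
  have hd : 0 < ρ₂ - ρ₁ := sub_pos.2 h12
  set b : ℝ := (ρ - ρ₁) / (ρ₂ - ρ₁) with hb
  have hb0 : 0 ≤ b := div_nonneg (sub_nonneg.2 hlo) hd.le
  have hb1 : b ≤ 1 := (div_le_one hd).2 (by linarith)
  set a : ℝ := 1 - b with ha
  have ha0 : 0 ≤ a := by linarith
  have hab : a + b = 1 := by ring
  have hρ : ρ = a * ρ₁ + b * ρ₂ := by
    rw [ha, hb]; field_simp; ring
  have h := emeryEnergyDensity_convex_comb_le θ (emeryStates_nonempty hρ₁ (by linarith))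
    (emeryStates_nonempty (by linarith) hρ₂) ha0 hb0 hab
  rw [← hρ] at h
  have h' : emeryEnergyDensity θ ρ ≤ a * c₁ + b * c₂ := by
    nlinarith [mul_le_mul_of_nonneg_left hc₁ ha0, mul_le_mul_of_nonneg_left hc₂ hb0]
  have heq : a * c₁ + b * c₂ = c₁ + (c₂ - c₁) * (ρ - ρ₁) / (ρ₂ - ρ₁) := by
    rw [ha, hb]; field_simp; ring
  linarith [heq]

end Literature.MathematicalPhysics.QuantumLattice

end
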